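import Literature.NumberTheory.Automorphic.SelbergTransformStrip
import Literature.NumberTheory.LFunctions.HalfIsolatedZeroDerivBounds
import HarnessLib

/-!
# Analytic continuation in a parameter preserves measurability in the variable

Topic `Literature/NumberTheory/Automorphic`; theorems only, no definition, no named fact.

Let `G : ℂ → X → ℂ` be a family of functions on a measurable space `X`, holomorphic in the
parameter `s` for every fixed `x`. If `x ↦ G(s, x)` is (a.e.-strongly) measurable for all `s` in
some open set `V` of parameters, then it is measurable for every parameter `s` reachable from `V`
by analytic continuation inside a disc of holomorphy: the Taylor expansion at a centre `c ∈ V`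
(Mathlib `Complex.hasSum_taylorSeries_on_ball`) exhibits `G(s, ·)` as a pointwise limit of finite
linear combinations of the iterated `s`-derivatives `∂ₛⁿ G(c, ·)`, and these are measurable as
iterated pointwise limits of difference quotients (the tree's
`aestronglyMeasurable_deriv_family`, `SelbergTransformStrip` §0; holomorphy of the iterated
derivatives on an open set is the tree's `MaynardPratt.differentiableOn_iteratedDeriv_of_isOpen`).

* `aestronglyMeasurable_iteratedDeriv_family` — `x ↦ ∂ₛⁿ G(s₀, x)` is measurable (`s₀ ∈ U` open,
  `G(s, ·)` measurable for `s ∈ U`);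
* `aestronglyMeasurable_of_differentiableOn_ball` — **disc version**: `G(·, x)` holomorphic on
  `ball c r`, `G(s, ·)` measurable for `s` in an open `V ∋ c` ⟹ measurable for all `s ∈ ball c r`;
* `aestronglyMeasurable_of_differentiableOn_re` — **half-plane version**: `G(·, x)` holomorphic
  on `Re s > a`, `G(s, ·)` measurable for `Re s > b` ⟹ measurable for all `Re s > a` (one disc
  centred far to the right suffices);
* `measurable_deriv_family`, `measurable_iteratedDeriv_family`,
  `measurable_of_differentiableOn_ball`, `measurable_of_differentiableOn_re` — the same with Borel
  measurability (`Measurable`) in place of a.e.-strong measurability for a measure.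

This is the measurability input for holomorphic parametric integrals
(`differentiableOn_integral_mul_of_bound`) of analytically continued kernels such as Hecke's
weight-one Eisenstein series `E₁,χ(z, s)` beyond its half-plane of convergence (Rankin–Selberg
integrals at `s = 0`). Everything is proved. [folklore]

## References

* W. Rudin, *Real and Complex Analysis*, 3rd ed., Thm. 10.16 (Taylor expansion in a disc) and
  Thm. 1.14 (pointwise limits of measurable functions are measurable).
-/

noncomputable section

namespace Literature.NumberTheory.Automorphic

open MeasureTheory Set Filter Metric _root_.Topology
open scoped Nat

variable {X : Type*} [MeasurableSpace X] {μ : Measure X}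

/-- **Iterated parameter-derivatives of a measurable holomorphic family are measurable**: if each
`s ↦ G(s, x)` is holomorphic on the open `U` and `G(s, ·)` is a.e.-strongly measurable for every
`s ∈ U`, then so is `x ↦ ∂ₛⁿ G(s₀, x)` for `s₀ ∈ U`. [folklore] -/
theorem aestronglyMeasurable_iteratedDeriv_family {G : ℂ → X → ℂ} {U : Set ℂ} (hU : IsOpen U)
    (hdiff : ∀ x, DifferentiableOn ℂ (fun s => G s x) U)
    (hmeas : ∀ s ∈ U, AEStronglyMeasurable (G s) μ) (n : ℕ) {s₀ : ℂ} (hs₀ : s₀ ∈ U) :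
    AEStronglyMeasurable (fun x => iteratedDeriv n (fun s => G s x) s₀) μ := by
  induction n generalizing s₀ with
  | zero => simpa using hmeas s₀ hs₀
  | succ n ih =>
    have hdiff' : ∀ x, DifferentiableOn ℂ (fun s => iteratedDeriv n (fun s => G s x) s) U :=
      fun x => LFunctions.MaynardPratt.differentiableOn_iteratedDeriv_of_isOpen hU (hdiff x) n
    have h := aestronglyMeasurable_deriv_family (μ := μ)
      (G := fun s x => iteratedDeriv n (fun s => G s x) s) hU hdiff' (fun s hs => ih hs) hs₀
    simpa [iteratedDeriv_succ] using h

/-- **Analytic continuation preserves measurability (disc version)**: if each `s ↦ G(s, x)` is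
holomorphic on the disc `ball c r` and `G(s, ·)` is a.e.-strongly measurable for all `s` in some
open `V ∋ c`, then `G(s₀, ·)` is a.e.-strongly measurable for every `s₀ ∈ ball c r` (Taylor
expansion at `c`: `G(s₀, x) = Σₙ (n!)⁻¹ (s₀ - c)ⁿ ∂ₛⁿ G(c, x)`, a pointwise limit of measurable
functions). [folklore] -/
theorem aestronglyMeasurable_of_differentiableOn_ball {G : ℂ → X → ℂ} {c : ℂ} {r : ℝ} {V : Set ℂ}
    (hdiff : ∀ x, DifferentiableOn ℂ (fun s => G s x) (ball c r)) (hV : IsOpen V) (hcV : c ∈ V)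
    (hmeas : ∀ s ∈ V, AEStronglyMeasurable (G s) μ) {s₀ : ℂ} (hs₀ : s₀ ∈ ball c r) :
    AEStronglyMeasurable (G s₀) μ := by
  have hr : 0 < r := pos_of_mem_ball hs₀
  set W : Set ℂ := V ∩ ball c r with hW
  have hWo : IsOpen W := hV.inter isOpen_ball
  have hcW : c ∈ W := ⟨hcV, mem_ball_self hr⟩
  have hdiffW : ∀ x, DifferentiableOn ℂ (fun s => G s x) W :=
    fun x => (hdiff x).mono inter_subset_right
  have hD : ∀ n, AEStronglyMeasurable (fun x => iteratedDeriv n (fun s => G s x) c) μ := fun n =>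
    aestronglyMeasurable_iteratedDeriv_family hWo hdiffW (fun s hs => hmeas s hs.1) n hcW
  have hsum : ∀ x, HasSum
      (fun n : ℕ => (n ! : ℂ)⁻¹ • (s₀ - c) ^ n • iteratedDeriv n (fun s => G s x) c) (G s₀ x) :=
    fun x => Complex.hasSum_taylorSeries_on_ball (hdiff x) hs₀
  have hlim : ∀ᵐ x ∂μ, Tendsto (fun N => ∑ n ∈ Finset.range N,
      (n ! : ℂ)⁻¹ • (s₀ - c) ^ n • iteratedDeriv n (fun s => G s x) c) atTop (𝓝 (G s₀ x)) :=
    Eventually.of_forall fun x => (hsum x).tendsto_sum_nat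
  refine aestronglyMeasurable_of_tendsto_ae atTop (fun N => ?_) hlim
  exact Finset.aestronglyMeasurable_fun_sum (Finset.range N)
    fun n _ => ((hD n).const_smul ((s₀ - c) ^ n)).const_smul ((n ! : ℂ)⁻¹)

/-- **Analytic continuation preserves measurability (half-plane version)**: if each `s ↦ G(s, x)`
is holomorphic on the half-plane `Re s > a` and `G(s, ·)` is a.e.-strongly measurable whenever
`Re s > b`, then `G(s₀, ·)` is a.e.-strongly measurable for every `Re s₀ > a` (apply the disc
version to the disc centred at `c = s₀ + t`, `t = max (b - Re s₀ + 1) 1`, of radius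
`t + (Re s₀ - a) = Re c - a`, which lies in the half-plane and contains `s₀`). [folklore] -/
theorem aestronglyMeasurable_of_differentiableOn_re {G : ℂ → X → ℂ} {a b : ℝ}
    (hdiff : ∀ x, DifferentiableOn ℂ (fun s => G s x) {s : ℂ | a < s.re})
    (hmeas : ∀ s : ℂ, b < s.re → AEStronglyMeasurable (G s) μ) {s₀ : ℂ} (hs₀ : a < s₀.re) :
    AEStronglyMeasurable (G s₀) μ := by
  set t : ℝ := max (b - s₀.re + 1) 1 with ht
  have ht0 : 0 < t := lt_of_lt_of_le one_pos (le_max_right _ _)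
  set c : ℂ := s₀ + (t : ℂ) with hc
  have hcre : c.re = s₀.re + t := by simp [hc]
  set ρ : ℝ := t + (s₀.re - a) with hρ
  -- the disc lies in the half-plane
  have hball : ball c ρ ⊆ {s : ℂ | a < s.re} := by
    intro s hs
    rw [mem_ball, dist_eq_norm] at hs
    have h1 : |(s - c).re| ≤ ‖s - c‖ := Complex.abs_re_le_norm _
    have h2 : (s - c).re = s.re - c.re := by simp
    rw [h2] at h1
    have h3 : c.re - s.re < ρ := lt_of_le_of_lt (by linarith [neg_abs_le (s.re - c.re)]) hs
    show a < s.re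
    rw [hcre, hρ] at h3
    linarith
  have hs₀ball : s₀ ∈ ball c ρ := by
    rw [mem_ball, dist_eq_norm, hc, show s₀ - (s₀ + (t : ℂ)) = -(t : ℂ) by ring, norm_neg,
      Complex.norm_real, Real.norm_of_nonneg ht0.le, hρ]
    linarith
  have hVo : IsOpen {s : ℂ | b < s.re} := isOpen_lt continuous_const Complex.continuous_re
  have hcV : c ∈ {s : ℂ | b < s.re} := by
    show b < c.re
    rw [hcre]
    have : b - s₀.re + 1 ≤ t := le_max_left _ _
    linarith
  exact aestronglyMeasurable_of_differentiableOn_ball (fun x => (hdiff x).mono hball) hVo hcV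
    (fun s hs => hmeas s hs) hs₀ball

/-! ### Borel-measurable versions

The same statements with `Measurable` in place of `AEStronglyMeasurable … μ` (no measure involved):
pointwise limits of measurable functions into `ℂ` are measurable
(Mathlib `measurable_of_tendsto_metrizable`). -/

/-- **The parameter-derivative of a measurable holomorphic family is measurable** (sequential
difference quotients). [folklore] -/
theorem measurable_deriv_family {G : ℂ → X → ℂ} {U : Set ℂ} (hU : IsOpen U)
    (hdiff : ∀ x, DifferentiableOn ℂ (fun s => G s x) U) (hmeas : ∀ s ∈ U, Measurable (G s))
    {s₀ : ℂ} (hs₀ : s₀ ∈ U) : Measurable fun x => deriv (fun s => G s x) s₀ := by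
  obtain ⟨ρ, hρ, hρU⟩ := Metric.isOpen_iff.mp hU s₀ hs₀
  set tseq : ℕ → ℝ := fun n => (ρ / 2) / ((n : ℝ) + 1) with htseq
  have htpos : ∀ n, 0 < tseq n := fun n => by rw [htseq]; positivity
  have htle : ∀ n, tseq n ≤ ρ / 2 := fun n => by
    rw [htseq]
    exact div_le_self (by linarith) (by linarith [(Nat.cast_nonneg n : (0 : ℝ) ≤ n)])
  have htend : Tendsto tseq atTop (𝓝 0) := by
    rw [htseq]
    exact tendsto_const_nhds.div_atTop (tendsto_natCast_atTop_atTop.atTop_add tendsto_const_nhds)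
  have htend' : Tendsto (fun n => ((tseq n : ℝ) : ℂ)) atTop (𝓝[≠] 0) := by
    rw [tendsto_nhdsWithin_iff]
    refine ⟨?_, Eventually.of_forall fun n => ?_⟩
    · have := (Complex.continuous_ofReal.tendsto 0).comp htend
      rw [Complex.ofReal_zero] at this
      exact this
    · simp only [mem_compl_iff, mem_singleton_iff, Complex.ofReal_eq_zero]
      exact (htpos n).ne'
  have hmemU : ∀ n, s₀ + ((tseq n : ℝ) : ℂ) ∈ U := fun n => hρU (by
    rw [mem_ball, dist_eq_norm, add_sub_cancel_left, Complex.norm_real,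
      Real.norm_of_nonneg (htpos n).le]
    linarith [htle n])
  set q : ℕ → X → ℂ := fun n x => ((tseq n : ℝ) : ℂ)⁻¹ • (G (s₀ + (tseq n : ℂ)) x - G s₀ x)
    with hq
  have hqm : ∀ n, Measurable (q n) := fun n =>
    ((hmeas _ (hmemU n)).sub (hmeas s₀ hs₀)).const_smul ((((tseq n : ℝ) : ℂ))⁻¹)
  refine measurable_of_tendsto_metrizable hqm ?_
  rw [tendsto_pi_nhds]
  intro x
  have hdx : HasDerivAt (fun s => G s x) (deriv (fun s => G s x) s₀) s₀ :=
    ((hdiff x s₀ hs₀).differentiableAt (hU.mem_nhds hs₀)).hasDerivAt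
  exact hdx.tendsto_slope_zero.comp htend'

/-- Iterated parameter-derivatives of a measurable holomorphic family are measurable. [folklore] -/
theorem measurable_iteratedDeriv_family {G : ℂ → X → ℂ} {U : Set ℂ} (hU : IsOpen U)
    (hdiff : ∀ x, DifferentiableOn ℂ (fun s => G s x) U) (hmeas : ∀ s ∈ U, Measurable (G s))
    (n : ℕ) {s₀ : ℂ} (hs₀ : s₀ ∈ U) : Measurable fun x => iteratedDeriv n (fun s => G s x) s₀ := by
  induction n generalizing s₀ with
  | zero => simpa using hmeas s₀ hs₀
  | succ n ih =>
    have hdiff' : ∀ x, DifferentiableOn ℂ (fun s => iteratedDeriv n (fun s => G s x) s) U :=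
      fun x => LFunctions.MaynardPratt.differentiableOn_iteratedDeriv_of_isOpen hU (hdiff x) n
    have h := measurable_deriv_family (G := fun s x => iteratedDeriv n (fun s => G s x) s) hU
      hdiff' (fun s hs => ih hs) hs₀
    simpa [iteratedDeriv_succ] using h

/-- **Analytic continuation preserves Borel measurability (disc version).** [folklore] -/
theorem measurable_of_differentiableOn_ball {G : ℂ → X → ℂ} {c : ℂ} {r : ℝ} {V : Set ℂ}
    (hdiff : ∀ x, DifferentiableOn ℂ (fun s => G s x) (ball c r)) (hV : IsOpen V) (hcV : c ∈ V)
    (hmeas : ∀ s ∈ V, Measurable (G s)) {s₀ : ℂ} (hs₀ : s₀ ∈ ball c r) :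
    Measurable (G s₀) := by
  have hr : 0 < r := pos_of_mem_ball hs₀
  set W : Set ℂ := V ∩ ball c r with hW
  have hWo : IsOpen W := hV.inter isOpen_ball
  have hcW : c ∈ W := ⟨hcV, mem_ball_self hr⟩
  have hdiffW : ∀ x, DifferentiableOn ℂ (fun s => G s x) W :=
    fun x => (hdiff x).mono inter_subset_right
  have hD : ∀ n, Measurable (fun x => iteratedDeriv n (fun s => G s x) c) := fun n =>
    measurable_iteratedDeriv_family hWo hdiffW (fun s hs => hmeas s hs.1) n hcW
  have hsum : ∀ x, HasSum
      (fun n : ℕ => (n ! : ℂ)⁻¹ • (s₀ - c) ^ n • iteratedDeriv n (fun s => G s x) c) (G s₀ x) :=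
    fun x => Complex.hasSum_taylorSeries_on_ball (hdiff x) hs₀
  refine measurable_of_tendsto_metrizable (f := fun N x => ∑ n ∈ Finset.range N,
      (n ! : ℂ)⁻¹ • (s₀ - c) ^ n • iteratedDeriv n (fun s => G s x) c) (fun N => ?_) ?_
  · exact Finset.measurable_sum (Finset.range N)
      fun n _ => ((hD n).const_smul ((s₀ - c) ^ n)).const_smul ((n ! : ℂ)⁻¹)
  · rw [tendsto_pi_nhds]
    exact fun x => (hsum x).tendsto_sum_nat

/-- **Analytic continuation preserves Borel measurability (half-plane version)**: `G(·, x)`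
holomorphic on `Re s > a`, `G(s, ·)` measurable for `Re s > b` ⟹ `G(s₀, ·)` measurable for every
`Re s₀ > a`. [folklore] -/
theorem measurable_of_differentiableOn_re {G : ℂ → X → ℂ} {a b : ℝ}
    (hdiff : ∀ x, DifferentiableOn ℂ (fun s => G s x) {s : ℂ | a < s.re})
    (hmeas : ∀ s : ℂ, b < s.re → Measurable (G s)) {s₀ : ℂ} (hs₀ : a < s₀.re) :
    Measurable (G s₀) := by
  set t : ℝ := max (b - s₀.re + 1) 1 with ht
  have ht0 : 0 < t := lt_of_lt_of_le one_pos (le_max_right _ _)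
  set c : ℂ := s₀ + (t : ℂ) with hc
  have hcre : c.re = s₀.re + t := by simp [hc]
  set ρ : ℝ := t + (s₀.re - a) with hρ
  have hball : ball c ρ ⊆ {s : ℂ | a < s.re} := by
    intro s hs
    rw [mem_ball, dist_eq_norm] at hs
    have h1 : |(s - c).re| ≤ ‖s - c‖ := Complex.abs_re_le_norm _
    have h2 : (s - c).re = s.re - c.re := by simp
    rw [h2] at h1
    have h3 : c.re - s.re < ρ := lt_of_le_of_lt (by linarith [neg_abs_le (s.re - c.re)]) hs
    show a < s.re
    rw [hcre, hρ] at h3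
    linarith
  have hs₀ball : s₀ ∈ ball c ρ := by
    rw [mem_ball, dist_eq_norm, hc, show s₀ - (s₀ + (t : ℂ)) = -(t : ℂ) by ring, norm_neg,
      Complex.norm_real, Real.norm_of_nonneg ht0.le, hρ]
    linarith
  have hVo : IsOpen {s : ℂ | b < s.re} := isOpen_lt continuous_const Complex.continuous_re
  have hcV : c ∈ {s : ℂ | b < s.re} := by
    show b < c.re
    rw [hcre]
    have : b - s₀.re + 1 ≤ t := le_max_left _ _
    linarith
  exact measurable_of_differentiableOn_ball (fun x => (hdiff x).mono hball) hVo hcV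
    (fun s hs => hmeas s hs) hs₀ball

end Literature.NumberTheory.Automorphic
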